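import Summits.BirchSwinnertonDyer.BirchSwinnertonDyer.Theorems.PrintCf2RubinValueTwoTwistedZetaFamily
import Literature.NumberTheory.ComplexMultiplication.EllipticUnits.ImaginaryQuadraticMainConjectureCarriersOTransfer
import Literature.NumberTheory.ComplexMultiplication.EllipticUnits.ImaginaryQuadraticMainConjectureCarriersOCores
import HarnessLib

/-!
# Route `SignedLowerHalves`, crux L `SmallImageLowerHalfBothSigns` (stmt-BirchSwinnertonDyer-23599), line `rtt_w3` — row D2-O-EXIST,
# UNIT HALF, FILE 1: the `𝒪`-coefficient Kato–Kummer system `c^𝒪_{𝔞,s,k} := (Kummer_k(u_{𝔞,s}⁻¹)) ⊗ t_p(χ)` and the zeta family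
# `y^𝒪_{𝔞,n,k} = cor_{K(p^s𝔣)/K̃_n}(c^𝒪_{𝔞,s,k})` on the `ℤ_p²`-layers, independent of `s`, compatible in `n` and `k`

INPUTS hand `bsd-inputs-honda-p1` g22 (prover-bsd-inputs-honda-p1-g22-0) for LEAD `cruxlead-stmt-BirchSwinnertonDyer-23599` g9 (cell
`bsd-ssimc`); ROUTE-INDEPENDENT helper (`--supports stmt-BirchSwinnertonDyer-23599`); THEOREMS ONLY — no definition, no named fact, no
instance, no `sorry`. The prints enter ONLY as displayed hypotheses, exactly as in route C's `…Theorems.PrintCf2.TwistedZeta.exists_zetaFamily`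
((E) `Kato2004.sec155_exists_katoUnitRep`, (O1) `DeShalit1987.prop25_i_normRelation` + `prop24_i_mem_rayClassField`). HONEST FRAMING:
bookkeeping towards `Nonempty (JohnsonLeungKings2011.TwistedIwasawaDataO …)` (the hypothesis structure of honda g22's named fact
`cor53_thm52ShapeO`); nothing here closes the crux; BSD is not proved by any of this.

WHAT. For an `𝒪 = 𝒪_{ℚ_p(S)}`-valued character `θ` trivial on `Gal(K̄/K(𝔣))` and the trivial `ℤ_p`-character `θ₀` (`∀ σ, θ₀ σ = 1`):
* §1 tower bookkeeping for `relCoresO` (the `𝒪` twins of -w2 g17's `RelCoresTower` lemmas, from honda g22's `relCoresO_relCoresO_one` /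
  `relCoresO_levelRedO`): `relCoresO_eq_of_norm_compatible`, `relCoresO_target_eq_of_norm_compatible`,
  `relCoresO_pairLayer_eq_of_norm_compatible`, `layerCoresO_relCoresO_pairLayer`, `layerRedO_relCoresO_pairLayer`;
* §2 **`exists_katoKummerSystemO`** — route C's system `(s₀, u, β, c)` at `θ₀` (`exists_katoKummerSystem`) pushed through
  `⊗ t_p(χ)` (`levelTransferO`, §3.3 (5)): classes `c^𝒪 a s k ∈ H¹(G_S(K(p^s𝔣)), 𝒪 ⊗ μ_{p^k} ⊗ θ)` which are `t_p(χ) ⊗` twisted Kummer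
  classes of `β` (`IsTwistedKummerClassO`), with the REDUCTION and NORM laws (transported by `levelRedO_levelTransferO`,
  `relCoresO_levelTransferO`) and the CONJUGATION law `conj_γ c^𝒪 = θ(γ) · T(conj_γ c)`;
* §3 **`exists_zetaFamilyO`** — the compatible family `y^𝒪 a n k ∈ H¹(G_S(K̃_n), 𝒪 ⊗ μ_{p^k} ⊗ θ)` (`IsCompatibleFamilyO … 1`) with
  `y^𝒪 a n k = relCoresO_{Gal(K̄/K̃_n) ← Gal(K̄/K(p^s𝔣))} (c^𝒪 a s k)` for every large `s` ("`_𝔞ζ_{K_n}(χ) = tr_{K(𝔣_χp^{r+n})/K_n}(_𝔞z ⊗ t(χ))`",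
  Burungale–Flach, proof of Lemma 7; JLK §5.2 "`_𝔞ζ(χ) := lim←_n _𝔞ζ_{K_n}(χ)`").

References: J. Johnson-Leung, G. Kings (2011) §3.3 (5)–(6), Def. 3.5, Def. 4.2 (94), §5.2; A. Burungale, M. Flach (2024) §3.2, §4.1 Lemma 7;
K. Kato, Astérisque 295 §8.2, §15.5.
-/

noncomputable section

open scoped Classical

-- the summit namespace `Summit.BirchSwinnertonDyer.BirchSwinnertonDyer` repeats the problem name by design (D-0017)
set_option linter.dupNamespace false
set_option autoImplicit false

open scoped NumberField
open Field IsDedekindDomain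
open Literature.NumberTheory.NumberFields (rayClassField)
open Literature.NumberTheory.GaloisRepresentations Literature.NumberTheory.GaloisRepresentations.DiscreteGaloisModule
open Literature.NumberTheory.EllipticCurves
open Literature.NumberTheory.ComplexMultiplication.EllipticUnits
open Literature.NumberTheory.ComplexMultiplication.EllipticUnits.JohnsonLeungKings2011
open Summit.BirchSwinnertonDyer.BirchSwinnertonDyer.Theorems.PrintCf2.RelCoresTower
open Summit.BirchSwinnertonDyer.BirchSwinnertonDyer.Theorems.PrintCf2.TwistedZeta

namespace Summit.BirchSwinnertonDyer.BirchSwinnertonDyer.Theorems.SmallImageRttD2OUnits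

/-! ## §1 Tower bookkeeping for `relCoresO` -/

section Tower

variable {K : Type} [Field K] [NumberField K] {p : ℕ} [Fact p.Prime] (S : Set (PadicAlgCl p))
  (P : Set (HeightOneSpectrum (𝓞 K))) (θ : absoluteGaloisGroup K →ₜ* (padicCoeffIntegers S)ˣ)
  {U : ℕ → Subgroup (absoluteGaloisGroup K)} (hUo : ∀ s, IsOpen (U s : Set (absoluteGaloisGroup K)))
  (hUa : Antitone U)

include hUa in
/-- **Iterated norm-compatibility** along an antitone tower of open subgroups (transitivity of `relCoresO`).
[cite: JohnsonLeungKings2011, Def. 3.5 (arXiv p0010:L70–80, transitivity of `tr`)] -/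
theorem relCoresO_eq_of_norm_compatible {k : ℕ} (c : ∀ s : ℕ, levelCohO S P θ (U s) k 1) {S₀ : ℕ}
    (hc : ∀ s : ℕ, S₀ ≤ s →
      relCoresO S P θ (hUa (Nat.le_succ s)) (hUo s) (hUo (s + 1)) k 1 (c (s + 1)) = c s)
    {s s' : ℕ} (hs : S₀ ≤ s) (hss' : s < s') :
    relCoresO S P θ (hUa hss'.le) (hUo s) (hUo s') k 1 (c s') = c s := by
  induction s' with
  | zero => exact absurd hss' (Nat.not_lt_zero s)
  | succ t ih =>
    rcases (Nat.lt_succ_iff.mp hss').eq_or_lt with rfl | hlt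
    · exact hc s hs
    · rw [← relCoresO_relCoresO_one S P θ (hUa (Nat.le_succ t)) (hUa hlt.le) (hUo s) (hUo t) (hUo (t + 1)) k
        (c (t + 1)), hc t (by omega)]
      exact ih hlt

include hUa in
/-- **The component at an open `V ⊇ U_s` is independent of the auxiliary level**: `relCoresO_{V ← U_{s′}} (c s′) =
relCoresO_{V ← U_s} (c s)` for `S₀ ≤ s ≤ s′`. [cite: JohnsonLeungKings2011, Def. 3.5 and §5.2 (arXiv p0010:L70–80, p0014:L60–70)] -/
theorem relCoresO_target_eq_of_norm_compatible {k : ℕ} (c : ∀ s : ℕ, levelCohO S P θ (U s) k 1) {S₀ : ℕ}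
    (hc : ∀ s : ℕ, S₀ ≤ s →
      relCoresO S P θ (hUa (Nat.le_succ s)) (hUo s) (hUo (s + 1)) k 1 (c (s + 1)) = c s)
    {V : Subgroup (absoluteGaloisGroup K)} (hV : IsOpen (V : Set (absoluteGaloisGroup K)))
    {s s' : ℕ} (hs : S₀ ≤ s) (hss' : s ≤ s') (hsV : U s ≤ V) :
    relCoresO S P θ ((hUa hss').trans hsV) hV (hUo s') k 1 (c s') =
      relCoresO S P θ hsV hV (hUo s) k 1 (c s) := by
  rcases hss'.eq_or_lt with rfl | hlt
  · rfl
  · rw [← relCoresO_eq_of_norm_compatible S P θ hUo hUa c hc hs hlt,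
      relCoresO_relCoresO_one S P θ (hUa hlt.le) hsV hV (hUo s) (hUo s') k (c s')]

end Tower

section KatoTower

variable {K : Type} [Field K] [NumberField K] {p : ℕ} [Fact p.Prime] (S : Set (PadicAlgCl p))
  (θ : absoluteGaloisGroup K →ₜ* (padicCoeffIntegers S)ˣ) (𝔣 : Ideal (𝓞 K)) (κ₁ κ₂ : ZpExtension K p)

/-- **THE LAYER COMPONENT IS WELL DEFINED** along Kato's tower `U_s = Gal(K̄/K(p^s𝔣))`: for a family norm-compatible from `S₀` on,
`relCoresO_{Gal(K̄/K̃_n) ← U_{s′}} (c s′) = relCoresO_{Gal(K̄/K̃_n) ← U_s} (c s)` whenever `S₀ ≤ s ≤ s′`, `K̃_n ⊆ K(p^s𝔣)`.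
[cite: JohnsonLeungKings2011, Def. 3.5 and §5.2 (arXiv p0010:L70–80, p0014:L60–70)] [cite: Kato2004Asterisque, §15.5 (p. 253)] -/
theorem relCoresO_pairLayer_eq_of_norm_compatible (h𝔣 : 𝔣 ≠ ⊥) {k : ℕ}
    (c : ∀ s : ℕ, levelCohO S (suppPF p 𝔣) θ (katoLevelSubgroup p 𝔣 s) k 1) {S₀ : ℕ}
    (hc : ∀ s : ℕ, S₀ ≤ s →
      relCoresO S (suppPF p 𝔣) θ (katoLevelSubgroup_antitone p 𝔣 h𝔣 (Nat.le_succ s))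
        (isOpen_katoLevelSubgroup p 𝔣 s) (isOpen_katoLevelSubgroup p 𝔣 (s + 1)) k 1 (c (s + 1)) = c s)
    (n : ℕ) {s s' : ℕ} (hs : S₀ ≤ s) (hss' : s ≤ s')
    (hsn : katoLevelSubgroup p 𝔣 s ≤ JohnsonLeungKings2011.pairLayerSubgroup κ₁ κ₂ n) :
    relCoresO S (suppPF p 𝔣) θ ((katoLevelSubgroup_antitone p 𝔣 h𝔣 hss').trans hsn)
        (JohnsonLeungKings2011.isOpen_pairLayerSubgroup κ₁ κ₂ n) (isOpen_katoLevelSubgroup p 𝔣 s') k 1 (c s') =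
      relCoresO S (suppPF p 𝔣) θ hsn (JohnsonLeungKings2011.isOpen_pairLayerSubgroup κ₁ κ₂ n)
        (isOpen_katoLevelSubgroup p 𝔣 s) k 1 (c s) :=
  relCoresO_target_eq_of_norm_compatible S (suppPF p 𝔣) θ (isOpen_katoLevelSubgroup p 𝔣)
    (katoLevelSubgroup_antitone p 𝔣 h𝔣) c hc (JohnsonLeungKings2011.isOpen_pairLayerSubgroup κ₁ κ₂ n) hs hss' hsn

/-- **(P1) for such components**: `layerCoresO` of the level-`(n+1)` corestriction is the level-`n` one (transitivity).
[cite: JohnsonLeungKings2011, Def. 4.2 (94) (arXiv p0012:L94)] -/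
theorem layerCoresO_relCoresO_pairLayer {k : ℕ} {s : ℕ} (n : ℕ)
    (hsn : katoLevelSubgroup p 𝔣 s ≤ JohnsonLeungKings2011.pairLayerSubgroup κ₁ κ₂ (n + 1))
    (x : levelCohO S (suppPF p 𝔣) θ (katoLevelSubgroup p 𝔣 s) k 1) :
    layerCoresO S κ₁ κ₂ θ 𝔣 n k 1
        (relCoresO S (suppPF p 𝔣) θ hsn (JohnsonLeungKings2011.isOpen_pairLayerSubgroup κ₁ κ₂ (n + 1))
          (isOpen_katoLevelSubgroup p 𝔣 s) k 1 x) =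
      relCoresO S (suppPF p 𝔣) θ (hsn.trans (JohnsonLeungKings2011.pairLayerSubgroup_antitone κ₁ κ₂ (Nat.le_succ n)))
        (JohnsonLeungKings2011.isOpen_pairLayerSubgroup κ₁ κ₂ n) (isOpen_katoLevelSubgroup p 𝔣 s) k 1 x :=
  relCoresO_relCoresO_one S (suppPF p 𝔣) θ hsn (JohnsonLeungKings2011.pairLayerSubgroup_antitone κ₁ κ₂ (Nat.le_succ n))
    (JohnsonLeungKings2011.isOpen_pairLayerSubgroup κ₁ κ₂ n) (JohnsonLeungKings2011.isOpen_pairLayerSubgroup κ₁ κ₂ (n + 1))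
    (isOpen_katoLevelSubgroup p 𝔣 s) k x

/-- **(P2) for such components**: from a red-law at Kato's level, `layerRedO` of the corestriction of `c′` is the corestriction of `c`.
[cite: Kato2004Asterisque, §8.2 (p. 180)] [cite: JohnsonLeungKings2011, Def. 4.2 (94) (arXiv p0012:L94)] -/
theorem layerRedO_relCoresO_pairLayer {k : ℕ} {s : ℕ} (n : ℕ)
    (hsn : katoLevelSubgroup p 𝔣 s ≤ JohnsonLeungKings2011.pairLayerSubgroup κ₁ κ₂ n)
    (c' : levelCohO S (suppPF p 𝔣) θ (katoLevelSubgroup p 𝔣 s) (k + 1) 1)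
    (c : levelCohO S (suppPF p 𝔣) θ (katoLevelSubgroup p 𝔣 s) k 1)
    (hred : levelRedO S (suppPF p 𝔣) θ (katoLevelSubgroup p 𝔣 s) k 1 c' = c) :
    layerRedO S κ₁ κ₂ θ 𝔣 n k 1
        (relCoresO S (suppPF p 𝔣) θ hsn (JohnsonLeungKings2011.isOpen_pairLayerSubgroup κ₁ κ₂ n)
          (isOpen_katoLevelSubgroup p 𝔣 s) (k + 1) 1 c') =
      relCoresO S (suppPF p 𝔣) θ hsn (JohnsonLeungKings2011.isOpen_pairLayerSubgroup κ₁ κ₂ n)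
        (isOpen_katoLevelSubgroup p 𝔣 s) k 1 c := by
  rw [← hred]
  exact (relCoresO_levelRedO S (suppPF p 𝔣) θ hsn (JohnsonLeungKings2011.isOpen_pairLayerSubgroup κ₁ κ₂ n)
    (isOpen_katoLevelSubgroup p 𝔣 s) k 1 c').symm

end KatoTower

/-! ## §2 The `𝒪`-coefficient Kato–Kummer system: route C's `θ₀ = 1` system pushed through `⊗ t_p(χ)` -/

section System

variable {K : Type} [Field K] [NumberField K] (p : ℕ) [Fact p.Prime] (S : Set (PadicAlgCl p))
  (θ₀ : absoluteGaloisGroup K →ₜ* ℤ_[p]ˣ) (θ : absoluteGaloisGroup K →ₜ* (padicCoeffIntegers S)ˣ) (𝔣 : Ideal (𝓞 K))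

/-- `θ` is trivial on `Gal(K̄/K(p^s𝔣)) ⊆ Gal(K̄/K(𝔣))`. [cite: JohnsonLeungKings2011, §3.3 (arXiv p0010:L63–68)] -/
theorem applyO_eq_one_of_mem_katoLevelSubgroup (χ : absoluteGaloisGroup K →ₜ* (padicCoeffIntegers S)ˣ) (h𝔣 : 𝔣 ≠ ⊥)
    (hχ𝔣 : ∀ σ ∈ absGaloisFixingSubgroup (rayClassField K 𝔣), χ σ = 1) (s : ℕ) {σ : absoluteGaloisGroup K}
    (hσ : σ ∈ katoLevelSubgroup p 𝔣 s) : χ σ = 1 :=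
  hχ𝔣 σ ((mem_absGaloisFixingSubgroup_iff _ σ).mpr fun x hx ↦
    (mem_absGaloisFixingSubgroup_iff _ σ).mp hσ x (rayClassField_le_katoLayer p 𝔣 h𝔣 s hx))

/-- `θ` is trivial on `N_S ≤ Gal(K̄/K(p^s𝔣))` (`S = {v ∣ p𝔣}`). [cite: JohnsonLeungKings2011, §4.2 (arXiv p0012:L72–78)] -/
theorem applyO_eq_one_of_mem_ramificationSubgroup (h𝔣 : 𝔣 ≠ ⊥)
    (hθ𝔣 : ∀ σ ∈ absGaloisFixingSubgroup (rayClassField K 𝔣), θ σ = 1) {σ : absoluteGaloisGroup K}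
    (hσ : σ ∈ ramificationSubgroup K (suppPF p 𝔣)) : θ σ = 1 :=
  applyO_eq_one_of_mem_katoLevelSubgroup p S 𝔣 θ h𝔣 hθ𝔣 0 (ramificationSubgroup_suppPF_le_katoLevelSubgroup p 𝔣 h𝔣 0 hσ)

/-- **`χ(σ_𝔞)` does not depend on the level**: `θ((𝔞, K(p^s𝔣)/K)) = θ((𝔞, K(𝔣)/K)) = thetaArtinO`.
[cite: Kato2004Asterisque, §15.3 (p. 252)] [cite: JohnsonLeungKings2011, §5.1 (arXiv p0014:L12–26)] -/
theorem theta_layerArtin_eq_thetaArtinO (h𝔣 : 𝔣 ≠ ⊥)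
    (hθ𝔣 : ∀ σ ∈ absGaloisFixingSubgroup (rayClassField K 𝔣), θ σ = 1) (s : ℕ) (a : AuxIdeals p 𝔣) :
    θ (layerArtin p 𝔣 s a.1) = thetaArtinO S θ 𝔣 a := by
  have h := applyO_eq_one_of_mem_katoLevelSubgroup p S 𝔣 θ h𝔣 hθ𝔣 0
    (layerArtin_inv_mul_layerArtin_mem_of_isTwist (p := p) (𝔣 := 𝔣) (Nat.zero_le s) h𝔣 a.2)
  rw [map_mul, map_inv, inv_mul_eq_one] at h
  exact h.symm

/-- `((1 : ZMod p^k).val : ℤ) • y = y` on a `p^k`-torsion group (the `θ₀ = 1` case of the `χ(σ_𝔞)⁻¹ mod p^k` scalar of route C).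
[cite: JohnsonLeungKings2011, §3.3 (5) (arXiv p0010:L61–70)] -/
theorem zsmul_val_one_eq_self {M : Type*} [AddCommGroup M] (k : ℕ) {y : M} (hy : p ^ k • y = 0) :
    ((PadicInt.toZModPow k (((1 : ℤ_[p]ˣ)⁻¹ : ℤ_[p]ˣ) : ℤ_[p])).val : ℤ) • y = y := by
  have hp : p.Prime := Fact.out
  rw [inv_one, Units.val_one, map_one, ZMod.val_one_eq_one_mod]
  rcases Nat.eq_zero_or_pos k with rfl | hk
  · rw [pow_zero, one_smul] at hy
    rw [hy, smul_zero]
  · rw [Nat.mod_eq_of_lt (Nat.one_lt_pow hk.ne' hp.one_lt), Nat.cast_one, one_smul]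

/-- **THE `𝒪`-COEFFICIENT KATO–KUMMER SYSTEM over all levels** (`K` imaginary quadratic, `𝔣 ≠ 0`, `θ` trivial on `Gal(K̄/K(𝔣))`,
`θ₀` the trivial `ℤ_p`-character): from (E), (O1), (O2): a threshold `s₀ ≥ 1`, Kato representatives `u_{𝔞,s}` (genuine for `s ≥ s₀`),
roots `β_{𝔞,s,k}^{p^k} = u_{𝔞,s}⁻¹` and classes `c^𝒪_{𝔞,s,k} ∈ H¹(G_S(K(p^s𝔣)), 𝒪 ⊗ μ_{p^k} ⊗ θ)` — the transfers `T c_{𝔞,s,k}`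
(`levelTransferO`, §3.3 (5)) of route C's twisted Kummer classes at `θ₀`, hence `t_p(χ) ⊗` twisted Kummer classes of `β`
(`IsTwistedKummerClassO`) — with the REDUCTION law in `k`, the NORM law `cor_{K(p^{s+1}𝔣)/K(p^s𝔣)} c^𝒪_{s+1,k} = c^𝒪_{s,k}`
(`s ≥ s₀`, `s ≥ k+2`), and the INDEPENDENCE identity (Z2) at the Kato level
`N𝔟·c^𝒪_𝔞 − χ(σ_𝔟)⁻¹·conj_{σ_𝔟} c^𝒪_𝔞 = N𝔞·c^𝒪_𝔟 − χ(σ_𝔞)⁻¹·conj_{σ_𝔞} c^𝒪_𝔟` (route C's `indep_at_katoLevel` at `θ₀`, pushed by `T` with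
the conjugation law `conj_γ (T c) = θ(γ)·T(conj_γ c)`). [cite: JohnsonLeungKings2011, §3.3 (5)–(6), Def. 3.5, Prop. 3.3 (3), §5.1–5.2 (arXiv p0009:L88–95, p0010:L55–80, p0014:L18–26, L80–99)] [cite: Kato2004Asterisque, §15.5 (p. 253)] [cite: BurungaleFlach2024, §3.2 (arXiv p0013:L30–36)] -/
theorem exists_katoKummerSystemO (hE : Kato2004.sec155_exists_katoUnitRep) (h25 : DeShalit1987.prop25_i_normRelation)
    (h24i : DeShalit1987.prop24_i_mem_rayClassField) (h24ii : DeShalit1987.prop24_ii_galoisAction) (hK : IsImaginaryQuadratic K)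
    (ι : K →+* ℂ) (h𝔣 : 𝔣 ≠ ⊥) (hθ₀ : ∀ σ, θ₀ σ = 1) (hθ𝔣 : ∀ σ ∈ absGaloisFixingSubgroup (rayClassField K 𝔣), θ σ = 1) :
    ∃ (s₀ : ℕ) (u : AuxIdeals p 𝔣 → ℕ → (AlgebraicClosure K)ˣ) (β : AuxIdeals p 𝔣 → ℕ → ℕ → (AlgebraicClosure K)ˣ)
      (cO : ∀ (a : AuxIdeals p 𝔣) (s k : ℕ), levelCohO S (suppPF p 𝔣) θ (katoLevelSubgroup p 𝔣 s) k 1),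
      1 ≤ s₀ ∧
      (∀ a s, s₀ ≤ s → IsKatoUnitRep p ι 𝔣 s a.1 (u a s)) ∧
      (∀ a s k, β a s k ^ (p ^ k) = (u a s)⁻¹) ∧
      (∀ a s k, IsTwistedKummerClassO S θ (suppPF p 𝔣) (katoLevelSubgroup p 𝔣 s) k (β a s k) (cO a s k)) ∧
      (∀ a s k, levelRedO S (suppPF p 𝔣) θ (katoLevelSubgroup p 𝔣 s) k 1 (cO a s (k + 1)) = cO a s k) ∧
      (∀ a s k, s₀ ≤ s → k + 2 ≤ s →
        relCoresO S (suppPF p 𝔣) θ (katoLevelSubgroup_antitone p 𝔣 h𝔣 (Nat.le_succ s))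
          (isOpen_katoLevelSubgroup p 𝔣 s) (isOpen_katoLevelSubgroup p 𝔣 (s + 1)) k 1
          (cO a (s + 1) k) = cO a s k) ∧
      (∀ (a b : AuxIdeals p 𝔣) (s k : ℕ), s₀ ≤ s → k + 2 ≤ s →
        ((Ideal.absNorm b.1 : ℕ) : ℤ) • cO a s k -
            levelScalarO S (suppPF p 𝔣) θ (katoLevelSubgroup p 𝔣 s) k 1
                (((thetaArtinO S θ 𝔣 b)⁻¹ : (padicCoeffIntegers S)ˣ) : padicCoeffIntegers S)
              (levelConjO S (suppPF p 𝔣) θ (katoLevelSubgroup p 𝔣 s) k 1 (layerArtin p 𝔣 s b.1) (cO a s k)) =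
          ((Ideal.absNorm a.1 : ℕ) : ℤ) • cO b s k -
            levelScalarO S (suppPF p 𝔣) θ (katoLevelSubgroup p 𝔣 s) k 1
                (((thetaArtinO S θ 𝔣 a)⁻¹ : (padicCoeffIntegers S)ˣ) : padicCoeffIntegers S)
              (levelConjO S (suppPF p 𝔣) θ (katoLevelSubgroup p 𝔣 s) k 1 (layerArtin p 𝔣 s a.1) (cO b s k))) := by
  haveI : NumberField.IsTotallyComplex K := hK.2
  have hθ₀𝔣 : ∀ σ ∈ absGaloisFixingSubgroup (rayClassField K 𝔣), θ₀ σ = 1 := fun σ _ ↦ hθ₀ σ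
  obtain ⟨s₀, u, β, c, hs₀, hu, -, hβ, hc, hred, hnorm⟩ := exists_katoKummerSystem p θ₀ 𝔣 hE h25 h24i hK ι h𝔣 hθ₀𝔣
  -- standing trivialities of the two characters
  have hθ₀N : ∀ g ∈ ramificationSubgroup K (suppPF p 𝔣), θ₀ g = 1 := fun g _ ↦ hθ₀ g
  have hθN : ∀ g ∈ ramificationSubgroup K (suppPF p 𝔣), θ g = 1 :=
    fun g hg ↦ applyO_eq_one_of_mem_ramificationSubgroup p S θ 𝔣 h𝔣 hθ𝔣 hg
  have hθ₀U : ∀ (s : ℕ), ∀ g ∈ katoLevelSubgroup p 𝔣 s, θ₀ g = 1 := fun s g _ ↦ hθ₀ g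
  have hθU : ∀ (s : ℕ), ∀ g ∈ katoLevelSubgroup p 𝔣 s, θ g = 1 :=
    fun s g hg ↦ applyO_eq_one_of_mem_katoLevelSubgroup p S 𝔣 θ h𝔣 hθ𝔣 s hg
  -- the transfer at level `s`
  let T : ∀ s k : ℕ, levelCoh p (suppPF p 𝔣) θ₀ (katoLevelSubgroup p 𝔣 s) k 1 →+
      levelCohO S (suppPF p 𝔣) θ (katoLevelSubgroup p 𝔣 s) k 1 :=
    fun s k ↦ levelTransferO S (suppPF p 𝔣) θ₀ θ (katoLevelSubgroup p 𝔣 s) hθ₀N hθN (hθ₀U s) (hθU s) k 1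
  refine ⟨s₀, u, β, fun a s k ↦ T s k (c a s k), hs₀, hu, hβ, fun a s k ↦ ?_, fun a s k ↦ ?_, fun a s k hs hks ↦ ?_,
    fun a b s k hs hks ↦ ?_⟩
  · -- `t_p(χ) ⊗` twisted Kummer class
    exact isTwistedKummerClassO_levelTransferO S (suppPF p 𝔣) θ₀ θ (katoLevelSubgroup p 𝔣 s) hθ₀N hθN (hθ₀U s) (hθU s) k
      (β a s k) (c a s k) (hc a s k)
  · -- reduction law
    change levelRedO S (suppPF p 𝔣) θ (katoLevelSubgroup p 𝔣 s) k 1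
        (levelTransferO S (suppPF p 𝔣) θ₀ θ (katoLevelSubgroup p 𝔣 s) hθ₀N hθN (hθ₀U s) (hθU s) (k + 1) 1 (c a s (k + 1))) =
      levelTransferO S (suppPF p 𝔣) θ₀ θ (katoLevelSubgroup p 𝔣 s) hθ₀N hθN (hθ₀U s) (hθU s) k 1 (c a s k)
    rw [levelRedO_levelTransferO, hred]
  · -- norm law
    change relCoresO S (suppPF p 𝔣) θ (katoLevelSubgroup_antitone p 𝔣 h𝔣 (Nat.le_succ s))
        (isOpen_katoLevelSubgroup p 𝔣 s) (isOpen_katoLevelSubgroup p 𝔣 (s + 1)) k 1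
        (levelTransferO S (suppPF p 𝔣) θ₀ θ (katoLevelSubgroup p 𝔣 (s + 1)) hθ₀N hθN (hθ₀U (s + 1)) (hθU (s + 1)) k 1
          (c a (s + 1) k)) =
      levelTransferO S (suppPF p 𝔣) θ₀ θ (katoLevelSubgroup p 𝔣 s) hθ₀N hθN (hθ₀U s) (hθU s) k 1 (c a s k)
    rw [relCoresO_levelTransferO, hnorm a s k hs hks]
  · -- (Z2) at the Kato level: route C's identity at `θ₀`, its scalars `≡ 1`, pushed through `T`
    have hs1 : 1 ≤ s := hs₀.trans hs
    have hU : IsOpen (katoLevelSubgroup p 𝔣 s : Set (absoluteGaloisGroup K)) := isOpen_katoLevelSubgroup p 𝔣 s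
    have key := indep_at_katoLevel p θ₀ 𝔣 h24ii hK ι h𝔣 hθ₀𝔣 hs1 hks a b (hu a s hs) (hu b s hs) (hβ a s k) (hβ b s k)
      (hc a s k) (hc b s k)
    have h1 : ∀ x : AuxIdeals p 𝔣, thetaArtin p θ₀ 𝔣 x = 1 := fun x ↦ hθ₀ _
    rw [h1, h1, zsmul_val_one_eq_self p k (levelCoh_torsion p (suppPF p 𝔣) θ₀ hU k 1 _),
      zsmul_val_one_eq_self p k (levelCoh_torsion p (suppPF p 𝔣) θ₀ hU k 1 _)] at key
    -- `χ(σ)⁻¹ · conj_σ (T c) = T (conj_σ c)`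
    have hconj : ∀ (x : AuxIdeals p 𝔣) (y : levelCoh p (suppPF p 𝔣) θ₀ (katoLevelSubgroup p 𝔣 s) k 1),
        levelScalarO S (suppPF p 𝔣) θ (katoLevelSubgroup p 𝔣 s) k 1
            (((thetaArtinO S θ 𝔣 x)⁻¹ : (padicCoeffIntegers S)ˣ) : padicCoeffIntegers S)
            (levelConjO S (suppPF p 𝔣) θ (katoLevelSubgroup p 𝔣 s) k 1 (layerArtin p 𝔣 s x.1) (T s k y)) =
          T s k (levelConj p (suppPF p 𝔣) θ₀ (katoLevelSubgroup p 𝔣 s) k 1 (layerArtin p 𝔣 s x.1) y) := by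
      intro x y
      change levelScalarO S (suppPF p 𝔣) θ (katoLevelSubgroup p 𝔣 s) k 1 _
          (levelConjO S (suppPF p 𝔣) θ (katoLevelSubgroup p 𝔣 s) k 1 (layerArtin p 𝔣 s x.1)
            (levelTransferO S (suppPF p 𝔣) θ₀ θ (katoLevelSubgroup p 𝔣 s) hθ₀N hθN (hθ₀U s) (hθU s) k 1 y)) =
        levelTransferO S (suppPF p 𝔣) θ₀ θ (katoLevelSubgroup p 𝔣 s) hθ₀N hθN (hθ₀U s) (hθU s) k 1
          (levelConj p (suppPF p 𝔣) θ₀ (katoLevelSubgroup p 𝔣 s) k 1 (layerArtin p 𝔣 s x.1) y)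
      rw [levelConjO_levelTransferO S (suppPF p 𝔣) θ₀ θ (katoLevelSubgroup p 𝔣 s) hθ₀N hθN (hθ₀U s) (hθU s) k 1 (hθ₀ _),
        ← levelScalarO_mul, theta_layerArtin_eq_thetaArtinO p S θ 𝔣 h𝔣 hθ𝔣 s x, Units.inv_mul, levelScalarO_one]
    rw [hconj, hconj, ← map_zsmul, ← map_zsmul, ← map_sub, ← map_sub, key]

end System

/-! ## §3 The zeta family on the `ℤ_p²`-layers -/

section Zeta

variable {K : Type} [Field K] [NumberField K] (p : ℕ) [Fact p.Prime] (S : Set (PadicAlgCl p))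
  (θ₀ : absoluteGaloisGroup K →ₜ* ℤ_[p]ˣ) (θ : absoluteGaloisGroup K →ₜ* (padicCoeffIntegers S)ˣ) (𝔣 : Ideal (𝓞 K))
  (κ₁ κ₂ : ZpExtension K p)

/-- **THE `𝒪`-COEFFICIENT ZETA FAMILY ON THE `ℤ_p²`-LAYERS.** For `K` imaginary quadratic, `𝔣 ≠ 0`, `θ : Γ_K → 𝒪ˣ` trivial on
`Gal(K̄/K(𝔣))`, any pair `(κ₁, κ₂)`, from (E)/(O1)/(O2): the system `(s₀, u, β, c^𝒪)` of `exists_katoKummerSystemO` together with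
`y a n k ∈ H¹(G_S(K̃_n), 𝒪 ⊗ μ_{p^k} ⊗ θ)` such that (i) each `y a` is a compatible family in `(n, k)` (`IsCompatibleFamilyO … 1`) and (ii)
`y a n k = relCoresO_{Gal(K̄/K̃_n) ← Gal(K̄/K(p^s𝔣))} (c^𝒪 a s k)` for every `s ≥ s₀`, `s ≥ k+2` with `Gal(K̄/K(p^s𝔣)) ≤ Gal(K̄/K̃_n)`:
"`_𝔞ζ_{K̃_n}(χ,𝔣) = cor_{K(p^s𝔣)/K̃_n}(Kummer_k(ζ_{p^s𝔣}) ⊗ t_p(χ))`" (pin (Z1) levelwise), `_𝔞ζ(χ) = lim←_n _𝔞ζ_{K̃_n}(χ)` (§5.2);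
(iii) the (Z2) identity at every large Kato level.
[cite: JohnsonLeungKings2011, Def. 3.5, Def. 4.2 (94), §5.2 (arXiv p0010:L72–80, p0012:L94, p0014:L80–90)] [cite: BurungaleFlach2024, §3.2 and §4.1 Lemma 7 with proof (arXiv p0013:L30–36, p0017:L50–68)] [cite: Kato2004Asterisque, §8.2 (p. 180), §15.5 (p. 253)] -/
theorem exists_zetaFamilyO (hE : Kato2004.sec155_exists_katoUnitRep) (h25 : DeShalit1987.prop25_i_normRelation)
    (h24i : DeShalit1987.prop24_i_mem_rayClassField) (h24ii : DeShalit1987.prop24_ii_galoisAction) (hK : IsImaginaryQuadratic K)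
    (ι : K →+* ℂ) (h𝔣 : 𝔣 ≠ ⊥) (hθ₀ : ∀ σ, θ₀ σ = 1) (hθ𝔣 : ∀ σ ∈ absGaloisFixingSubgroup (rayClassField K 𝔣), θ σ = 1) :
    ∃ (s₀ : ℕ) (u : AuxIdeals p 𝔣 → ℕ → (AlgebraicClosure K)ˣ) (β : AuxIdeals p 𝔣 → ℕ → ℕ → (AlgebraicClosure K)ˣ)
      (cO : ∀ (a : AuxIdeals p 𝔣) (s k : ℕ), levelCohO S (suppPF p 𝔣) θ (katoLevelSubgroup p 𝔣 s) k 1)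
      (y : AuxIdeals p 𝔣 → ∀ n k : ℕ, layerCohO S κ₁ κ₂ θ 𝔣 n k 1),
      1 ≤ s₀ ∧
      (∀ a s, s₀ ≤ s → IsKatoUnitRep p ι 𝔣 s a.1 (u a s)) ∧
      (∀ a s k, β a s k ^ (p ^ k) = (u a s)⁻¹) ∧
      (∀ a s k, IsTwistedKummerClassO S θ (suppPF p 𝔣) (katoLevelSubgroup p 𝔣 s) k (β a s k) (cO a s k)) ∧
      (∀ a, IsCompatibleFamilyO S κ₁ κ₂ θ 𝔣 1 (y a)) ∧
      (∀ a n k s, s₀ ≤ s → k + 2 ≤ s → ∀ hle : katoLevelSubgroup p 𝔣 s ≤ JohnsonLeungKings2011.pairLayerSubgroup κ₁ κ₂ n,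
        y a n k = relCoresO S (suppPF p 𝔣) θ hle (JohnsonLeungKings2011.isOpen_pairLayerSubgroup κ₁ κ₂ n)
          (isOpen_absGaloisFixingSubgroup K (katoLayer p 𝔣 s)) k 1 (cO a s k)) ∧
      (∀ (a b : AuxIdeals p 𝔣) (s k : ℕ), s₀ ≤ s → k + 2 ≤ s →
        ((Ideal.absNorm b.1 : ℕ) : ℤ) • cO a s k -
            levelScalarO S (suppPF p 𝔣) θ (katoLevelSubgroup p 𝔣 s) k 1
                (((thetaArtinO S θ 𝔣 b)⁻¹ : (padicCoeffIntegers S)ˣ) : padicCoeffIntegers S)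
              (levelConjO S (suppPF p 𝔣) θ (katoLevelSubgroup p 𝔣 s) k 1 (layerArtin p 𝔣 s b.1) (cO a s k)) =
          ((Ideal.absNorm a.1 : ℕ) : ℤ) • cO b s k -
            levelScalarO S (suppPF p 𝔣) θ (katoLevelSubgroup p 𝔣 s) k 1
                (((thetaArtinO S θ 𝔣 a)⁻¹ : (padicCoeffIntegers S)ˣ) : padicCoeffIntegers S)
              (levelConjO S (suppPF p 𝔣) θ (katoLevelSubgroup p 𝔣 s) k 1 (layerArtin p 𝔣 s a.1) (cO b s k))) := by
  haveI : NumberField.IsTotallyComplex K := hK.2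
  obtain ⟨s₀, u, β, c, hs₀, hu, hβ, hc, hred, hnorm, hindep⟩ :=
    exists_katoKummerSystemO p S θ₀ θ 𝔣 hE h25 h24i h24ii hK ι h𝔣 hθ₀ hθ𝔣
  -- the norm law in the shape of the tower bookkeeping, threshold `max s₀ (k + 2)`
  have hnc : ∀ (a : AuxIdeals p 𝔣) (k s : ℕ), max s₀ (k + 2) ≤ s →
      relCoresO S (suppPF p 𝔣) θ (katoLevelSubgroup_antitone p 𝔣 h𝔣 (Nat.le_succ s)) (isOpen_katoLevelSubgroup p 𝔣 s)
        (isOpen_katoLevelSubgroup p 𝔣 (s + 1)) k 1 (c a (s + 1) k) = c a s k :=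
    fun a k s hs ↦ hnorm a s k (le_of_max_le_left hs) (le_of_max_le_right hs)
  -- independence of the auxiliary level
  have key : ∀ (a : AuxIdeals p 𝔣) (n k s s' : ℕ), max s₀ (k + 2) ≤ s → max s₀ (k + 2) ≤ s' →
      ∀ (hle : katoLevelSubgroup p 𝔣 s ≤ JohnsonLeungKings2011.pairLayerSubgroup κ₁ κ₂ n)
        (hle' : katoLevelSubgroup p 𝔣 s' ≤ JohnsonLeungKings2011.pairLayerSubgroup κ₁ κ₂ n),
      relCoresO S (suppPF p 𝔣) θ hle (JohnsonLeungKings2011.isOpen_pairLayerSubgroup κ₁ κ₂ n) (isOpen_katoLevelSubgroup p 𝔣 s) k 1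
          (c a s k) =
        relCoresO S (suppPF p 𝔣) θ hle' (JohnsonLeungKings2011.isOpen_pairLayerSubgroup κ₁ κ₂ n) (isOpen_katoLevelSubgroup p 𝔣 s')
          k 1 (c a s' k) := by
    intro a n k s s' hs hs' hle hle'
    rcases le_total s s' with h | h
    · exact (relCoresO_pairLayer_eq_of_norm_compatible S θ 𝔣 κ₁ κ₂ h𝔣 (fun t ↦ c a t k) (hnc a k) n hs h hle).symm
    · exact relCoresO_pairLayer_eq_of_norm_compatible S θ 𝔣 κ₁ κ₂ h𝔣 (fun t ↦ c a t k) (hnc a k) n hs' h hle'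
  -- levels fine enough for each layer and depth
  have HT : ∀ n k : ℕ, ∃ s, max s₀ (k + 2) ≤ s ∧ katoLevelSubgroup p 𝔣 s ≤ JohnsonLeungKings2011.pairLayerSubgroup κ₁ κ₂ n := by
    intro n k
    obtain ⟨s₁, hs₁⟩ := exists_katoLevelSubgroup_le_pairLayerSubgroup 𝔣 h𝔣 κ₁ κ₂ n
    exact ⟨max (max s₀ (k + 2)) s₁, le_max_left _ _, (katoLevelSubgroup_antitone p 𝔣 h𝔣 (le_max_right _ _)).trans hs₁⟩
  choose T hT using HT
  refine ⟨s₀, u, β, c, fun a n k ↦ relCoresO S (suppPF p 𝔣) θ (hT n k).2 (JohnsonLeungKings2011.isOpen_pairLayerSubgroup κ₁ κ₂ n)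
    (isOpen_katoLevelSubgroup p 𝔣 (T n k)) k 1 (c a (T n k) k), hs₀, hu, hβ, hc, fun a ↦ ⟨fun n k ↦ ?_, fun n k ↦ ?_⟩,
    fun a n k s hs hks hle ↦ ?_, hindep⟩
  · -- (P1) `cor_{K̃_{n+1}/K̃_n} y_{n+1,k} = y_{n,k}`
    exact (layerCoresO_relCoresO_pairLayer S θ 𝔣 κ₁ κ₂ n (hT (n + 1) k).2 (c a (T (n + 1) k) k)).trans
      (key a n k (T (n + 1) k) (T n k) (hT (n + 1) k).1 (hT n k).1
        ((hT (n + 1) k).2.trans (JohnsonLeungKings2011.pairLayerSubgroup_antitone κ₁ κ₂ (Nat.le_succ n))) (hT n k).2)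
  · -- (P2) `red y_{n,k+1} = y_{n,k}`
    have hm : max s₀ (k + 2) ≤ T n (k + 1) := (max_le_max le_rfl (by omega)).trans (hT n (k + 1)).1
    exact (layerRedO_relCoresO_pairLayer S θ 𝔣 κ₁ κ₂ n (hT n (k + 1)).2 (c a (T n (k + 1)) (k + 1)) (c a (T n (k + 1)) k)
      (hred a (T n (k + 1)) k)).trans (key a n k (T n (k + 1)) (T n k) hm (hT n k).1 (hT n (k + 1)).2 (hT n k).2)
  · -- the component at every large level
    exact (key a n k s (T n k) (max_le hs hks) (hT n k).1 hle (hT n k).2).symm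

end Zeta

end Summit.BirchSwinnertonDyer.BirchSwinnertonDyer.Theorems.SmallImageRttD2OUnits

end
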